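/-
Origin: expansion seat `prover-pub-hodgecm-mc-carch-1-g5-0`, handover #CA51 2026-08-20T11:10:16Z md5 2775532c31ef (164 l., 12 decls; NEW additive leaf; imports installed RUN-44 #CA29 Model.ArchKTypeOfLambda only; RUN 50; drop-alone; cert certs/ax-ArchKTypeOfLambdaConj-2775532c31ef.log: rc 0 / 23 s / 0 warnings / trio) (`HOME/mc/pub-hodgecm-mc-carch-1/pkg50/HodgeCM/Model/ArchKTypeOfLambdaConj.lean`, md5 2775532c31ef, 164 lines);
landed by the second packager p2 gen 7 (p2-g7) in gate run 50 as `HodgeCM/Model/ArchKTypeOfLambdaConj.lean` (verbatim).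
-/
/-
Copyright (c) 2026. Released under Apache 2.0 license as described in the file LICENSE.
Cell pub-hodgecm, MODEL layer (construction prover mc-carch-1, gen 5), BINDER-OWNERS row 12 `C`, junction (C-Λ)′, item (Λ-v₁) for the
CONJUGATED plane: the see-saw factor of the line-2 scalar on `Stab(x₀)` is `(det A · d)^{ℓ″}` for ONE integer `ℓ″` — the twin of RUN-44 #CA29.
-/
import Summits.HodgeConjecture.HodgeCM.Model.ArchKTypeOfLambda

/-!
# (C-Λ)′, item (Λ-v₁): the see-saw discrepancy of line 2 (conjugated plane) is a power of `det` on `K = Stab(x₀) ⊂ U(2,1)`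

Verbatim #CA29 `ArchKTypeOfLambda` on the conjugated plane (`cmLineChar₀ ↦ cmConjLineChar₀`, `hGR₀/hGR₁ ↦ hGR₂/hGR₃`, `η₀ ↦ η₂`,
`lineScalar_zero ↦ lineScalar_two` of #CA3, continuity from sinst #1208's `continuous_cmConjLineChar₀_of_signs`):

* § 1 `lambdaCharConj`, `lineScalar_two_eq_mul_lambdaCharConj` (definitional split of #CA3's line-2 scalar);
* § 2 `continuous_lambdaCharConj(_D₀)` from SIGN FACTS ONLY;
* § 3 **`exists_lambdaExponentConj`** / the exponent OF RECORD **`lambdaExponentConj V S hGR hGR₂ hGR₃ h₁W : ℤ`** (#CA28 `U21Char.exists_zpow_of_continuous`)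
  with `lambdaCharConj_blockU` / `lambdaCharConj_stabilizer`;
* § 4 **`lineScalar_two_stabilizer`** and the (χ)₂ socket **`hχ_two_of_archType`**: if the η₂-part is `(det A · d)^m` on `Stab(x₀)` and
  `m + ℓ″ + e_P = 0`, `m + ℓ″ + e_Q = −1`, then the `hχ₂` input of the k = 2 At-terms (#CA43/#CA47 `hχ`) HOLDS — at pin R2 the η₂-part is
  `χV · ν′⁻¹`, so (χ)₂ is a read-off condition on TYPES: `nVR (w ι₁) − n₃R (w ι₁) + ℓ″ + eP² = 0` (the (C-Σ)′ identity at `v₁`, sibling leaf).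

0 records, 0 `def … : Prop`, nothing cited as a hypothesis; the only non-kernel input is continuity from sign facts.
-/

set_option autoImplicit false

noncomputable section

open NumberField NumberField.mixedEmbedding IsDedekindDomain
open scoped Matrix Classical
open Literature.Geometry.ComplexHyperbolic Literature.Geometry.ComplexHyperbolic.BallModel
open Literature.NumberTheory.Automorphic Literature.NumberTheory.Automorphic.U21 Literature.NumberTheory.Weil1964
open Literature.NumberTheory.GelbartRogawski1991 Literature.NumberTheory.GelbartRogawski1991.UnitaryDualPair
open HodgeCM.Adelic HodgeCM.PerL34 HodgeCM.Model.HypCensus HodgeCM.Model.U21Char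

namespace HodgeCM.Model

namespace ArchSideTerm

variable {L : CMField} {ι₁ : L →+* ℂ} (V : HermSpace3 L ι₁) (S : StubTree.SeesawDatum L)

variable
  (hGR : (cmSplittingDatum (L : Type) finProdFinEquiv (frameD V) (frameD_real V) (frameD_ne V) (dW S) (dW_real S) (dW_ne S)).CompatibleSplitting)
  (hGR₂ : (cmSplittingDatum (L : Type) (e₁) (frameD V) (frameD_real V) (frameD_ne V) (lineVec (L : Type) (dW' S 0))
    (fun _ => dW'_real S 0) (fun _ => dW'_ne S 0)).CompatibleSplitting)
  (hGR₃ : (cmSplittingDatum (L : Type) (e₁) (frameD V) (frameD_real V) (frameD_ne V) (lineVec (L : Type) (dW' S 1))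
    (fun _ => dW'_real S 1) (fun _ => dW'_ne S 1)).CompatibleSplitting)
  (η₂ : CMAdelic (L : Type) (frameD V) × CMAdelicOne (L : Type) →* ℂˣ)

/-! ## § 1 The see-saw factor of the line-2 scalar -/

/-- **`λ″ : U(2,1) →* ℂˣ`, `u ↦ χ₂′((archSectionFrameOf V u)^𝔸, 1)`** — the see-saw discrepancy `cmConjLineChar₀` of the chosen splittings of the CONJUGATED plane
pulled back along the `ι₁`-section of record. -/
def lambdaCharConj : U21 →* ℂˣ :=
  (cmConjLineChar₀ (L : Type) finProdFinEquiv e₁ (frameD V) (frameD_real V) (frameD_ne V) (dW S) (dW_real S) (dW_ne S) (dW' S) (dW'_real S) (dW'_ne S) S.isoGL (isoGL_hg₀ S) hGR hGR₂ hGR₃).comp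
    (MonoidHom.prod ((UnitaryGroup.archToAdelic (↥(maximalRealSubfield L)) L (IsCMField.complexConj L) 3
      (Matrix.diagonal (frameD V))).comp (archSectionFrameOf V)) 1)

/-- (Ported verbatim from the HodgeCMPerL package; no docstring in the source.) -/
theorem lambdaCharConj_apply (u : U21) :
    lambdaCharConj V S hGR hGR₂ hGR₃ u =
      cmConjLineChar₀ (L : Type) finProdFinEquiv e₁ (frameD V) (frameD_real V) (frameD_ne V) (dW S) (dW_real S) (dW_ne S) (dW' S) (dW'_real S) (dW'_ne S) S.isoGL (isoGL_hg₀ S) hGR hGR₂ hGR₃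
        (UnitaryGroup.archToAdelic (↥(maximalRealSubfield L)) L (IsCMField.complexConj L) 3 (Matrix.diagonal (frameD V))
          (archSectionFrameOf V u), 1) :=
  rfl

/-- #CA3's line-2 scalar SPLITS as `(η₂-part) · λ` (definitional). -/
theorem lineScalar_two_eq_mul_lambdaCharConj :
    lineScalar_two V S hGR hGR₂ hGR₃ η₂ =
      (η₂.comp (MonoidHom.prod ((UnitaryGroup.archToAdelic (↥(maximalRealSubfield L)) L (IsCMField.complexConj L) 3
        (Matrix.diagonal (frameD V))).comp (archSectionFrameOf V)) 1)) * lambdaCharConj V S hGR hGR₂ hGR₃ :=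
  rfl

/-- (Ported verbatim from the HodgeCMPerL package; no docstring in the source.) -/
theorem lineScalar_two_apply_eq_mul (u : U21) :
    lineScalar_two V S hGR hGR₂ hGR₃ η₂ u =
      η₂ (UnitaryGroup.archToAdelic (↥(maximalRealSubfield L)) L (IsCMField.complexConj L) 3 (Matrix.diagonal (frameD V))
          (archSectionFrameOf V u), 1) * lambdaCharConj V S hGR hGR₂ hGR₃ u :=
  rfl

/-! ## § 2 Continuity on the circle `z ↦ diag(z, 1, 1)` from sign facts -/

variable (h₁W : (∀ j, 0 < (ι₁ (dW S j)).re) ∨ ∀ j, (ι₁ (dW S j)).re < 0)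

include h₁W in
/-- `u ↦ (λ u : ℂ)` is continuous on all of `U(2,1)`. -/
theorem continuous_lambdaCharConj : Continuous fun u : U21 => ((lambdaCharConj V S hGR hGR₂ hGR₃ u : ℂˣ) : ℂ) := by
  have hc := continuous_cmConjLineChar₀_of_signs (L : Type) finProdFinEquiv e₁ (frameD V) (frameD_real V) (frameD_ne V) (dW S)
    (dW_real S) (dW_ne S) hGR (dW' S) (dW'_real S) (dW'_ne S) S.isoGL (isoGL_hg₀ S) hGR₂ hGR₃ ι₁ (frameD_sign_ι₁' V) h₁W (frameD_sign_of_ne V)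
  have he : (fun u : U21 => ((lambdaCharConj V S hGR hGR₂ hGR₃ u : ℂˣ) : ℂ)) =
      (fun p => ((cmConjLineChar₀ (L : Type) finProdFinEquiv e₁ (frameD V) (frameD_real V) (frameD_ne V) (dW S) (dW_real S) (dW_ne S)
        (dW' S) (dW'_real S) (dW'_ne S) S.isoGL (isoGL_hg₀ S) hGR hGR₂ hGR₃ p : ℂˣ) : ℂ)) ∘
      fun u : U21 => (cmFrameEquiv (L : Type) (frameG V) V.Hm (frameD V) (frame_congr V)
        (UnitaryGroup.archSectionU21CM (L : Type) ι₁ V.Hm V.sylvesterFrame (sylvesterFrame_J V) u), (1 : CMAdelic (L : Type) (lineVec (L : Type) (dW' S 0)))) := by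
    funext u
    simp only [Function.comp_apply, lambdaCharConj_apply, cmFrameEquiv_archSectionU21CM]
  rw [he]
  exact hc.comp (((continuous_cmFrameEquiv (L : Type) (frameG V) V.Hm (frameD V) (frame_congr V)).comp
    (UnitaryGroup.continuous_archSectionU21CM (L : Type) ι₁ V.Hm V.sylvesterFrame (sylvesterFrame_J V))).prodMk continuous_const)

include h₁W in
/-- `z ↦ λ (diag(z, 1, 1))` is continuous on the circle. -/
theorem continuous_lambdaCharConj_D₀ :
    Continuous fun z : Circle => ((lambdaCharConj V S hGR hGR₂ hGR₃ (D₀ (circleToUnitary z)) : ℂˣ) : ℂ) :=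
  (continuous_lambdaCharConj V S hGR hGR₂ hGR₃ h₁W).comp continuous_D₀_circle

/-! ## § 3 The exponent `ℓ` of record -/

include h₁W in
/-- **(Λ-v₁)′**: the conjugated see-saw factor is `(det A · d)^ℓ` on `K = U(2) × U(1)` for ONE integer `ℓ`. -/
theorem exists_lambdaExponentConj :
    ∃ ℓ : ℤ, ∀ k : K21, ((lambdaCharConj V S hGR hGR₂ hGR₃ (blockU k) : ℂˣ) : ℂ) = ((matA k).det * sclD k) ^ ℓ :=
  exists_zpow_of_continuous _ (continuous_lambdaCharConj_D₀ V S hGR hGR₂ hGR₃ h₁W)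

/-- **the exponent OF RECORD** of the see-saw factor at `v₁` (one `Classical.choose`; unique by `CircleChar`, not needed here). -/
def lambdaExponentConj : ℤ := (exists_lambdaExponentConj V S hGR hGR₂ hGR₃ h₁W).choose

/-- (Ported verbatim from the HodgeCMPerL package; no docstring in the source.) -/
theorem lambdaCharConj_blockU (k : K21) :
    ((lambdaCharConj V S hGR hGR₂ hGR₃ (blockU k) : ℂˣ) : ℂ) = ((matA k).det * sclD k) ^ lambdaExponentConj V S hGR hGR₂ hGR₃ h₁W :=
  (exists_lambdaExponentConj V S hGR hGR₂ hGR₃ h₁W).choose_spec k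

/-- the same on `Stab(x₀)` through `stabilizerEquivK21`. -/
theorem lambdaCharConj_stabilizer (u : MulAction.stabilizer U21 x₀) :
    ((lambdaCharConj V S hGR hGR₂ hGR₃ (u : U21) : ℂˣ) : ℂ) =
      ((matA (stabilizerEquivK21.symm u)).det * sclD (stabilizerEquivK21.symm u)) ^ lambdaExponentConj V S hGR hGR₂ hGR₃ h₁W := by
  have hu : (u : U21) = blockU (stabilizerEquivK21.symm u) := by
    rw [← coe_blockK, ← stabilizerEquivK21_apply, MulEquiv.apply_symm_apply]
  rw [hu, lambdaCharConj_blockU]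

/-! ## § 4 The line-2 scalar on `Stab(x₀)` and the (χ)₂ socket -/

/-- **on `Stab(x₀)`: `lineScalar_two … η₂ u = η₂((archSectionFrameOf V u)^𝔸, 1) · (det A · d)^ℓ`.** -/
theorem lineScalar_two_stabilizer (u : MulAction.stabilizer U21 x₀) :
    ((lineScalar_two V S hGR hGR₂ hGR₃ η₂ (u : U21) : ℂˣ) : ℂ) =
      ((η₂ (UnitaryGroup.archToAdelic (↥(maximalRealSubfield L)) L (IsCMField.complexConj L) 3 (Matrix.diagonal (frameD V))
          (archSectionFrameOf V (u : U21)), 1) : ℂˣ) : ℂ) *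
        ((matA (stabilizerEquivK21.symm u)).det * sclD (stabilizerEquivK21.symm u)) ^ lambdaExponentConj V S hGR hGR₂ hGR₃ h₁W := by
  rw [lineScalar_two_apply_eq_mul, Units.val_mul, lambdaCharConj_stabilizer]

/-- **THE (χ)₂ SOCKET.**  If the η-part of the line-0 scalar is `(det A · d)^m` on `Stab(x₀)` and the types satisfy `m + ℓ + e_P = 0`,
`m + ℓ + e_Q = −1` (consistent iff `e_P − e_Q = 1`, binder-2's pinned difference for a line positive at `v₁`), then the `hχ₂`-type input of the k = 2 At-terms holds (the text of #CA43/#CA47's `hχ` at any exponent tuple `ev`). -/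
theorem hχ_two_of_archType {m : ℤ} (ev : Literature.RepresentationTheory.KonnoKonno2007.VacExponents)
    (hη : ∀ u : MulAction.stabilizer U21 x₀,
      ((η₂ (UnitaryGroup.archToAdelic (↥(maximalRealSubfield L)) L (IsCMField.complexConj L) 3 (Matrix.diagonal (frameD V))
          (archSectionFrameOf V (u : U21)), 1) : ℂˣ) : ℂ) =
        ((matA (stabilizerEquivK21.symm u)).det * sclD (stabilizerEquivK21.symm u)) ^ m)
    (hm : m + lambdaExponentConj V S hGR hGR₂ hGR₃ h₁W + ev.eP = 0) (hm' : m + lambdaExponentConj V S hGR hGR₂ hGR₃ h₁W + ev.eQ = -1)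
    (u : MulAction.stabilizer U21 x₀) :
    ((lineScalar_two V S hGR hGR₂ hGR₃ η₂ (u : U21) : ℂˣ) : ℂ) *
        ((matA (stabilizerEquivK21.symm u)).det ^ ev.eP * sclD (stabilizerEquivK21.symm u) ^ ev.eQ) =
      star (sclD (stabilizerEquivK21.symm u)) := by
  refine lineScalar_identity_of_exponents (χ := lineScalar_two V S hGR hGR₂ hGR₃ η₂)
    (m := m + lambdaExponentConj V S hGR hGR₂ hGR₃ h₁W) (m' := m + lambdaExponentConj V S hGR hGR₂ hGR₃ h₁W) (fun u => ?_) hm hm' u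
  have hA : (matA (stabilizerEquivK21.symm u)).det ≠ 0 := (Matrix.UnitaryGroup.det_isUnit (stabilizerEquivK21.symm u).1).ne_zero
  have hd : sclD (stabilizerEquivK21.symm u) ≠ 0 := fun h => by
    have h1 : star (sclD (stabilizerEquivK21.symm u)) * sclD (stabilizerEquivK21.symm u) = 1 :=
      Unitary.coe_star_mul_self (stabilizerEquivK21.symm u).2
    rw [h, mul_zero] at h1
    exact zero_ne_one h1
  rw [lineScalar_two_stabilizer, hη u, ← zpow_add₀ (mul_ne_zero hA hd), mul_zpow]

end ArchSideTerm

end HodgeCM.Model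

end
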